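import Literature.NumberTheory.DiophantineGeometry.FibreConductorKappaDefect
import Literature.NumberTheory.DiophantineGeometry.FibreConductorCritJunction
import Literature.NumberTheory.DiophantineGeometry.GenEllDeFamilyBadPrimesConverse
import Literature.NumberTheory.DiophantineGeometry.GenEllDeFamilyDefectChoice
import HarnessLib

/-!
# [GenEll] Thm. 2.1 on the `D_e` route, family `t_c`: the W5 conductor slope with NO separation at any
# finite prime — defect at EVERY bad prime including `2` (owner option «S₁ := ∅»)

S. Mochizuki, *Arithmetic elliptic curves in general position*, Math. J. Okayama Univ. **52** (2010), proof
of Thm. 2.1 p. 13 (Prop. 1.6 for the reduced divisor) [cite: MochizukiGenEll2010, Thm 2.1 proof p.13].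
Junction file (proof-only) for the abc-iut cell's route item `GenEllTwo` (stmt-ABC-19679). Since the
bad-place defect inequality (`GenEllDeBadPlaceDefectOfCrit`, abc-iut-w5-d090 and abc-iut-w5-d054) holds at EVERY prime —
`2` included — the conductor slope needs no `2`-adic separation input at all: feed
`FibreConductor.inv_finrank_mul_sum_logNorm_le_slope_of_prime_defect` (abc-iut-w5-d009) with the defect at
ALL places over `T ⊇ S(e,c,A)` and the B-free good-place dichotomy (`DeC.ord_placewise_of_crit`) off `T`.

* `DeC.slope_defect_of_splits` — `k ≥ 1`, `c ≠ 0`, `R_c` split in `K`, `A ∋` the critical values: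
  `∃ S ∋ 2` (primes) and `∃ Dp : ℕ → ℕ` such that for every number field `L ⊇ K`, every `T ⊇ S` of primes,
  every point datum `(r, s, t, N, x)` with `r s N ≠ 0`, every finite `B ⊇ A` with `t ∉ B`, every `W`
  meeting `B` off `T`, and ONLY the analytic inputs `harch`, `htH`, `hNH`, `hBH`:
  `(1/[L:ℚ])·Σ_{w∈W} log N(w) ≤ ((|B|(2k+4) − (6k+6))/(2k+1))·((1/[L:ℚ])·h_L(x)) +
   ((|B|C₄+C₅)/(2k+1) + |B|(C₆ + log 2) + Σ_{p∈T} Dp p·log p + Σ_{p∈T} log p + C₃)`.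

Classical; nothing here bears on [IUTchIII] Cor. 3.12.
-/

noncomputable section

namespace Literature.NumberTheory.DiophantineGeometry.GenEll

open _root_.Polynomial NumberField IsDedekindDomain
open Literature.IUT.LogVolume

universe u

open scoped Classical in
/-- **The W5 conductor slope, defect at every bad prime, no separation.** See the module docstring.
[cite: MochizukiGenEll2010, Thm 2.1 proof p.13] -/
theorem DeC.slope_defect_of_splits (k : ℕ) (hk : 1 ≤ k) {K : Type u} [Field K] [NumberField K]
    {c : K} (hc : c ≠ 0) (A : Finset K) (hsplit : (DeCrit.RpolyC k c).Splits)
    (hA : ∀ θ : K, (DeCrit.RpolyC k c).eval θ = 0 → DeCrit.tCritC k c θ ∈ A) :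
    ∃ S : Finset ℕ, 2 ∈ S ∧ (∀ p ∈ S, p.Prime) ∧ ∃ Dp : ℕ → ℕ,
      ∀ (L : Type u) [Field L] [NumberField L] [Algebra K L] (T : Finset ℕ), S ⊆ T →
        (∀ p ∈ T, p.Prime) →
        ∀ {r s t N x : L},
        s ^ 2 = 1 - 4 * r ^ (2 * k + 1) → t * (r * s) = s + algebraMap K L c * r ^ (k + 2) →
        N = -s ^ 3 + algebraMap K L c * ((k + 1) * r ^ (k + 2) - 2 * r ^ (3 * k + 3)) →
        r ≠ 0 → s ≠ 0 → N ≠ 0 →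
        ∀ (B : Finset L), A.map ⟨algebraMap K L, (algebraMap K L).injective⟩ ⊆ B →
        (∀ b ∈ B, t ≠ b) →
        ∀ (W : Finset (HeightOneSpectrum (𝓞 L))) {C₃ C₄ C₅ C₆ : ℝ},
        (∀ w ∈ W, w ∉ T.attach.biUnion (fun p => placesOver L p.1) → ∃ b ∈ B, 0 < ord L w (t - b)) →
        (∀ v : InfinitePlace L, Real.posLog (v N⁻¹) ≤ C₃) →
        ((2 * k + 1 : ℝ) * Height.logHeight₁ t ≤
          (2 * k + 4 : ℝ) * Height.logHeight₁ x + Module.finrank ℚ L * C₄) →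
        ((6 * k + 6 : ℝ) * Height.logHeight₁ x ≤
          (2 * k + 1 : ℝ) * Height.logHeight₁ N + Module.finrank ℚ L * C₅) →
        (∀ b ∈ B, Height.logHeight₁ b ≤ Module.finrank ℚ L * C₆) →
        (Module.finrank ℚ L : ℝ)⁻¹ * ∑ w ∈ W, logNorm L w ≤
          ((B.card * (2 * k + 4 : ℝ) - (6 * k + 6)) / (2 * k + 1)) *
              ((Module.finrank ℚ L : ℝ)⁻¹ * Height.logHeight₁ x) +
            ((B.card * C₄ + C₅) / (2 * k + 1) + B.card * (C₆ + Real.log 2) +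
              (∑ p ∈ T, (Dp p : ℝ) * Real.log p) + (∑ p ∈ T, Real.log p) + C₃) := by
  -- bad primes of the good-place package and of the converse direction
  obtain ⟨S₁, h2S₁, hS₁p, hS₁⟩ := DeC.exists_badPrimes (K := K) k hc A
  have hcritB : ∀ θ : K, (DeCrit.RpolyC k c).eval θ = 0 →
      ((1 - 2 * DeCrit.critXC k c θ) + c * θ ^ (k + 2)) / (θ * (1 - 2 * DeCrit.critXC k c θ)) ∈ A := by
    intro θ hθ
    have h := hA θ hθ
    rwa [← DeCrit.tC_critPointC (two_ne_zero : (2 : K) ≠ 0) c θ] at h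
  obtain ⟨S₂, -, hS₂p, hS₂⟩ := DeC.hconv_off_badPrimes (K := K) k hc A hsplit hcritB
  -- one defect function for all primes
  obtain ⟨Dp, hDp⟩ := DeC.exists_defectFn_of_crit.{u, u} k hk hc A hsplit hA
  refine ⟨S₁ ∪ S₂, Finset.mem_union_left _ h2S₁, fun p hp => ?_, Dp, ?_⟩
  · rcases Finset.mem_union.mp hp with h | h
    · exact hS₁p p h
    · exact hS₂p p h
  intro L _ _ _ T hST hT r s t N x hcurve ht hN hr hs hN0 B hAB htB W C₃ C₄ C₅ C₆ hW harch htH hNH hBH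
  set ι : K ↪ L := ⟨algebraMap K L, (algebraMap K L).injective⟩
  have hmono₁ : ∀ w : HeightOneSpectrum (𝓞 L), w ∉ T.attach.biUnion (fun p => placesOver L p.1) →
      w ∉ S₁.attach.biUnion (fun p => placesOver L p.1) := by
    intro w hw hwS
    obtain ⟨p, -, hp⟩ := Finset.mem_biUnion.mp hwS
    exact hw (Finset.mem_biUnion.mpr
      ⟨⟨p.1, hST (Finset.mem_union_left _ p.2)⟩, Finset.mem_attach _ _, hp⟩)
  have hS₂T : S₂ ⊆ T := fun p hp => hST (Finset.mem_union_right _ hp)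
  have htA : ∀ β ∈ A, t ≠ algebraMap K L β := fun β hβ => htB _ (hAB (Finset.mem_map_of_mem _ hβ))
  refine FibreConductor.inv_finrank_mul_sum_logNorm_le_slope_of_prime_defect k x t N B W T hT Dp
    (fun w hw => ?_) hW (fun p hp w hwp => ?_) harch htH hNH hBH
  · -- the B-free dichotomy at a good place
    obtain ⟨h2, hcv, hAint, -, hgap⟩ := hS₁ L w (hmono₁ w hw)
    refine DeC.ord_placewise_of_crit w k h2 hcv hcurve ht hN hN0 (A.map ι) B hAB htB
      (fun a => C ((algebraMap K L c) ^ 2) * X ^ (2 * k + 4) + C (4 * a ^ 2) * X ^ (2 * k + 3)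
        - C (8 * a) * X ^ (2 * k + 2) + C 4 * X ^ (2 * k + 1) - C (a ^ 2) * X ^ 2 + C (2 * a) * X - 1)
      (fun _ _ => rfl) ?_ ?_ ?_
    · intro a ha
      obtain ⟨b, hb, rfl⟩ := Finset.mem_map.mp ha
      exact hAint b hb
    · intro a ha ρ hρ hg0 hlt
      obtain ⟨b, hb, rfl⟩ := Finset.mem_map.mp ha
      exact hgap b hb _ rfl ρ hρ hg0 hlt
    · intro hN1
      exact hS₂ L T hS₂T w hw hcurve ht hN hN1
  · -- the defect at every place over `T`
    refine (hDp p (hT p hp) L w hwp r s t N hcurve ht hN hr hs hN0 htA).trans ?_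
    gcongr
    calc ∑ β ∈ A, (ord L w (t - algebraMap K L β)).toNat
        = ∑ b ∈ A.map ι, (ord L w (t - b)).toNat := by rw [Finset.sum_map]; rfl
      _ ≤ ∑ b ∈ B, (ord L w (t - b)).toNat := Finset.sum_le_sum_of_subset hAB

end Literature.NumberTheory.DiophantineGeometry.GenEll

end
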